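import Summits.QuantumFields.YangMills.Theorems.PencilRigidityDiagonalMirrorRPRReduction
import Literature.MathematicalPhysics.QuantumFieldTheory.TiltedTorusLatticeSchwinger

/-!
# Crux `DiagonalMirrorRPR` (stmt-QuantumFields-10604): the closing theorem of the recommended restatement, in
# Literature vocabulary

Crux `DiagonalMirrorRPR` of the routes `PencilRigidity` (#5) and `MirrorModularBoosts` (#4) of `YangMills` (shared verbatim).
The second line lead's assessment (`Cruxes/DiagonalMirrorRPR/Lines/parity-bridge-cold-traces-a1-assessment.md`) recommends
restating the crux as

  `W₁ r sch S₁ → (∀ᶠ k in atTop, 0 ≤ sch.β k) → CoverConv r sch S₁ → (reflection positivity in the four diagonal frames)`,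

where `CoverConv` is lattice convergence of the renormalised curvature strings to `S₁` on `⁰𝒮` ALSO on the swap reflection
positive 45° covers `T̃_{2L_k+1}` — the Literature function `tiltedLatticeSchwinger` (`TiltedTorusLatticeSchwinger.lean`), the
analogue of `latticeSchwinger` on the Fröhlich–Israel–Lieb–Simon tilted torus.  This file proves that restated statement
outright (`stub_restatedCrux_closes`, registered sub-goal of the item): the Summits-side `coverSchwinger` of the line
`parity-bridge-cold-traces` IS `tiltedLatticeSchwinger` on the curvature species (`coverSchwinger_eq_tiltedLatticeSchwinger`,
`rfl`), so the landed `Reduction.diagonalFrameRP_of_coverConvergence` (S1 exact swap-RP on the covers + S4' OS closure + tail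
shift) applies verbatim.

References: Fröhlich–Israel–Lieb–Simon, Comm. Math. Phys. 62 (1978) Thm 2.1 and J. Stat. Phys. 22 (1980) §3; Osterwalder–Schrader,
Comm. Math. Phys. 31 (1973) §2–3; Osterwalder–Seiler, Ann. Phys. 110 (1978) §2.
-/

set_option autoImplicit false

noncomputable section

open scoped SchwartzMap
open MeasureTheory Filter Topology
open Literature.MathematicalPhysics.QuantumLattice Literature.MathematicalPhysics.AQFT
  Literature.MathematicalPhysics.QuantumFieldTheory

namespace Summit.QuantumFields.YangMills.Cruxes.DiagonalMirrorRPR.ParityBridgeColdTraces.Reduction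

variable {G : Type} [Group G] [TopologicalSpace G] [IsTopologicalGroup G] [CompactSpace G]
  [MeasurableSpace G] [BorelSpace G]

/-- **Bridge.** The line's cover Schwinger function is the Literature tilted-torus lattice Schwinger function of the
curvature species (the Summits vocabulary `TSite (2N) N N`, `tstep true`, `texp`, `skewLift` is a verbatim copy of
`TiltedTorus.Site/step/expect/lift`). -/
theorem coverSchwinger_eq_tiltedLatticeSchwinger (r : LatticeRep G) (sch : SpeciesScheme (YMSpecies G)) (k n : ℕ)
    (f : Fin n → 𝓢(E4, ℝ)) :
    coverSchwinger r sch k n f = tiltedLatticeSchwinger r.ρ sch (fun s => s.F) k n (fun _ => r.curvature) f :=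
  rfl

/-- **The restated crux holds** (registered sub-goal `stub_restatedCrux_closes`).  For every compact simple `G`, lattice
representation `r`, scheme `sch` and one-species family `S₁`: the curvature package `W₁`, eventually non-negative couplings,
and convergence of the renormalised curvature strings to `S₁` on `⁰𝒮` along the 45° covers `T̃_{2L_k+1}` imply reflection
positivity of `S₁` in pull-back form in the four diagonal frames `R e₀ = (±e₀ ± e₁)/√2`. -/
theorem stub_restatedCrux_closes : ∀ (G : Type) [Group G] [TopologicalSpace G] [IsTopologicalGroup G] [CompactSpace G] [MeasurableSpace G] [BorelSpace G], IsCompactSimpleLieGroup G → ∀ (r : LatticeRep G) (sch : SpeciesScheme (YMSpecies G)) (S₁ : SchwingerFamily E4), CurvaturePackage r sch S₁ → (∀ᶠ k in atTop, 0 ≤ sch.β k) → (∀ (n : ℕ), n ≠ 0 → ∀ (f : Fin n → 𝓢(E4, ℝ)) (F : 𝓢((Fin n → E4), ℂ)), IsTensorOf F (fun i => ofRealTest (f i)) → IsOffDiagonal F → Tendsto (fun k : ℕ => ((tiltedLatticeSchwinger r.ρ sch (fun s => s.F) k n (fun _ => r.curvature) f : ℝ) : ℂ)) atTop (𝓝 (S₁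 n F))) → DiagonalFrameRP S₁ :=
  fun G _ _ _ _ _ _ hG r sch S₁ hW hβ hcc =>
    diagonalFrameRP_of_coverConvergence hG r sch S₁ hW hβ fun n hn f F hT hO => by
      simpa only [coverSchwinger_eq_tiltedLatticeSchwinger] using hcc n hn f F hT hO

/-- **The restated crux, in the binder shape of the route files** (`MeasurableSpace G := borel G`): a drop-in `_holds`
proof for `∀ G simple, r, sch, S₁, W₁ → (∀ᶠ k, 0 ≤ β_k) → CoverConv → DiagonalFrameRP`. -/
theorem restatedCrux_holds :
    ∀ (G : Type) [Group G] [TopologicalSpace G] [IsTopologicalGroup G] [CompactSpace G],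
      IsCompactSimpleLieGroup G →
        letI : MeasurableSpace G := borel G
        haveI : BorelSpace G := ⟨rfl⟩
        ∀ (r : LatticeRep G) (sch : SpeciesScheme (YMSpecies G)) (S₁ : SchwingerFamily E4),
          CurvaturePackage r sch S₁ → (∀ᶠ k in atTop, 0 ≤ sch.β k) →
            (∀ (n : ℕ), n ≠ 0 → ∀ (f : Fin n → 𝓢(E4, ℝ)) (F : 𝓢((Fin n → E4), ℂ)),
              IsTensorOf F (fun i => ofRealTest (f i)) → IsOffDiagonal F →
                Tendsto (fun k : ℕ => ((tiltedLatticeSchwinger r.ρ sch (fun s => s.F) k n (fun _ => r.curvature) f : ℝ) : ℂ))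
                  atTop (𝓝 (S₁ n F))) →
              DiagonalFrameRP S₁ := by
  intro G _ _ _ _ hG
  letI : MeasurableSpace G := borel G
  haveI : BorelSpace G := ⟨rfl⟩
  intro r sch S₁ hW hβ hcc
  exact stub_restatedCrux_closes G hG r sch S₁ hW hβ hcc

end Summit.QuantumFields.YangMills.Cruxes.DiagonalMirrorRPR.ParityBridgeColdTraces.Reduction

end
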